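import Literature.Probability.LatticeModels.MedialExplorationVertexEscapeB
import HarnessLib

/-!
# Escape along a lattice vertex path with forbidden CORNERS: the first vertices of the path may be domain sites

Topic `Literature/Probability/LatticeModels`; a variant of `MedialExplorationVertexEscape.lean`,
`MedialExplorationSideWinding.lean` and `MedialExplorationVertexEscapeB.lean`. There the escape path of a corner
`q = (u, j)` is the corner walk of a lattice vertex path from `u` back to the start vertex whose vertices after `u`
are FORBIDDEN VERTICES (sites on the dual-wired arc `B`, or sites none of whose faces is inner), and the path leaves
`u` along its `(j+1)`-st edge. For the first dart of the exploration at a site of the WIRED arc (a site `u ∈ A` one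
layer inside a straight wired side, with `u + u_{j+1}, u + u_{j+2} ∈ A`) no such path exists: the neighbour
`u + u_{j+1}` is an `A`-site with an inner face. What the escape mechanism (`IsEscape`, `IsEscape.of_list`) really
needs is only that every CORNER of the walk after `q` is forbidden (non-inner face, or vertex on `B`); leaving `u`
along its `(j+2)`-nd edge uses at `u` the corner `(u, j+1)` and at `u + u_{j+2}` corners of non-inner faces only.
This file records the corner-level statements, for an arbitrary first step:

* `cornerEscape_isEscape` / `turnCount_eq_of_cornerEscape_side` — the walk completed by the corner `(x₀, k₀ + 3)`
  of the non-inner face across the start edge (the path enters `x₀` along `k₀ + 1`): escape sum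
  `walkTurns j ds + 1`, and with an extreme corner of index `j + 3` for the side functional `sideVal j` the turn count
  at every passage of `(u, j)` before the exit is `-4 - (walkTurns j ds + 1)`;
* `cornerEscapeB_isEscape` / `turnCount_eq_of_cornerEscapeB_side` — the walk entering `x₀` through the start edge
  itself (last step `k₀ + 2`, from its `B`-end): escape sum `walkTurns j ds`, turn count `-4 - walkTurns j ds`.

Everything is proved.

## References

* H. Duminil-Copin, C. Hongler, P. Nolin, Comm. Pure Appl. Math. 64 (2011), Lemma 12.
  [DuminilCopinHonglerNolin2011]
* S. Smirnov, C. R. Acad. Sci. Paris 333 (2001), §2. [Smirnov2001]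
-/

namespace Literature.Probability.LatticeModels

open MedialTrail Finset DiscreteDobrushin

variable {D : DiscreteDobrushin}

section GadgetA

variable (hD : D.IsZdAdmissible) {u : Site 2} {j : Fin 4} {ds : List (Fin 4)}

/-- **A vertex path with forbidden corners is an escape path** (completion through the face across the start
edge). Hypotheses: the direction list is nonempty, the path ends at the start vertex `x₀` arriving along `k₀ + 1`,
every corner of its corner walk after the first is forbidden (non-inner face, or vertex on `B`), and the vertices of
the path together with `x₀` are pairwise distinct. Conclusion: the escape list is an escape path of `(u, j)` with
escape sum `walkTurns j ds + 1`. [cite: DuminilCopinHonglerNolin2011, Lemma 12] -/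
theorem cornerEscape_isEscape (hds : ds ≠ []) (hend : pathEnd u ds = (startCorner hD).1)
    (hlast : lastDir ds = (startCorner hD).2 + 1)
    (hforb : ∀ d ∈ (cornerWalk u j ds).tail, ¬ D.IsInnerFace (cFace d) ∨ d.1 ∈ D.zdArcB)
    (hnodup : (pathVerts u ds ++ [(startCorner hD).1]).Nodup) :
    IsEscape D hD (u, j) (fun i => (escapeList hD u j ds).getD i (startCorner hD)) ((escapeList hD u j ds).length - 2) ∧
      escapeSum (fun i => (escapeList hD u j ds).getD i (startCorner hD)) ((escapeList hD u j ds).length - 2) =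
        walkTurns j ds + 1 := by
  set p₁ : Site 2 × Fin 4 := ((startCorner hD).1, (startCorner hD).2 + 3) with hp₁
  have hWne : cornerWalk u j ds ≠ [] := cornerWalk_ne_nil u j hds
  have hL : escapeList hD u j ds = cornerWalk u j ds ++ [p₁] := rfl
  have hlen2 : (escapeList hD u j ds).length = ((escapeList hD u j ds).length - 2) + 2 := by
    rw [hL, List.length_append, List.length_singleton]
    have := List.length_pos_of_ne_nil hWne
    omega
  -- the arrival corner at the end vertex is `p₁`
  have harr : (pathEnd u ds, lastDir ds + 2) = p₁ := by
    rw [hend, hlast, hp₁, (fin4_escape_arith (startCorner hD).2).2]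
  have hc₀succ : startCorner hD = leftSucc p₁ := by
    rw [hp₁, leftSucc, (fin4_escape_arith (startCorner hD).2).1]
  -- the escape-path clauses
  have hEsc := IsEscape.of_list (hD := hD) (q := (u, j)) (escapeList hD u j ds) hlen2
    (by rw [hL, List.head?_append, head?_cornerWalk _ _ hds]; rfl)
    (by
      rw [hL]
      refine List.IsChain.append (isChain_cornerWalk u j ds) (List.isChain_singleton _) fun x hx y hy => ?_
      simp only [List.head?_cons, Option.mem_def, Option.some.injEq] at hy
      subst hy
      rw [Option.mem_def, List.getLast?_eq_some_getLast hWne, Option.some.injEq] at hx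
      subst hx
      rw [← harr]
      have key := isSucc_getLast_cornerWalk u j ds.dropLast (lastDir ds)
      have heq : ds.dropLast ++ [lastDir ds] = ds := (eq_dropLast_append_lastDir hds).symm
      simp only [heq] at key
      exact key)
    (by
      rw [hc₀succ]
      simp only [hL, List.getLast_append_of_ne_nil _ (List.cons_ne_nil _ _), List.getLast_singleton]
      exact Or.inl rfl)
    (by
      intro d hd
      obtain ⟨d₀, W, hW⟩ := List.exists_cons_of_ne_nil hWne
      rw [hL, hW, List.cons_append, List.tail_cons, List.mem_append, List.mem_singleton] at hd
      rcases hd with hd | rfl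
      · exact hforb d (by rw [hW, List.tail_cons]; exact hd)
      · exact Or.inl (isStartCorner_startCorner hD).isOutEdge.2)
    (by
      rw [hL]
      refine List.Nodup.append (nodup_cornerWalk (List.nodup_append.1 hnodup).1) (List.nodup_singleton _)
        fun d hd hd' => ?_
      rw [List.mem_singleton] at hd'
      subst hd'
      have h1 : (startCorner hD).1 ∈ pathVerts u ds := by simpa [hp₁] using fst_mem_pathVerts hd
      exact (List.nodup_append.1 hnodup).2.2 _ h1 _ (List.mem_singleton_self _) rfl)
  refine ⟨hEsc.1, ?_⟩
  rw [hEsc.2, hL, walkSign_append _ p₁ rfl, ← harr, walkSign_cornerWalk u j hds, harr, walkSign, hc₀succ, sgn_leftSucc]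

/-- **The winding at a corner with a corner-forbidden vertex escape, extreme corner for the side functional.**
If a corner `d` of the escape list has index `j + 3` and maximises `sideVal j ∘ cpos` over all corners with an
inner face and over the escape list, then at every passage of `(u, j)` before the exit
`turnCount = -4 - (walkTurns j ds + 1)`. [cite: DuminilCopinHonglerNolin2011, Lemma 12] -/
theorem turnCount_eq_of_cornerEscape_side (hds : ds ≠ []) (hend : pathEnd u ds = (startCorner hD).1)
    (hlast : lastDir ds = (startCorner hD).2 + 1)
    (hforb : ∀ d ∈ (cornerWalk u j ds).tail, ¬ D.IsInnerFace (cFace d) ∨ d.1 ∈ D.zdArcB)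
    (hnodup : (pathVerts u ds ++ [(startCorner hD).1]).Nodup)
    {d : Site 2 × Fin 4} (hd : d ∈ escapeList hD u j ds) (hidx : d.2 = j + 3)
    (hI : ∀ p : Site 2 × Fin 4, D.IsInnerFace (cFace p) → sideVal j (cpos p) ≤ sideVal j (cpos d))
    (hE : ∀ d' ∈ escapeList hD u j ds, sideVal j (cpos d') ≤ sideVal j (cpos d))
    (ω : Percolation.BondConfig (Site 2)) {t : ℕ} (ht : t < exitTime hD ω)
    (horb : cornerOrbit (D.bcBondConfig ω) (startCorner hD) t = (u, j)) :
    turnCount (D.bcBondConfig ω) (startCorner hD) t = -4 - (walkTurns j ds + 1) := by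
  obtain ⟨hEsc, hsum⟩ := cornerEscape_isEscape hD hds hend hlast hforb hnodup
  obtain ⟨m₀, hm₀, hm₀d⟩ := exists_index_of_mem_escapeList hD hd
  rw [← hsum]
  have hEm : ∀ m ≤ (escapeList hD u j ds).length - 2 + 1,
      sideVal j (cpos ((escapeList hD u j ds).getD m (startCorner hD))) ≤ sideVal j (cpos d) :=
    fun m hm => hE _ (getD_mem_escapeList hD hds hm)
  fin_cases j
  · simp only [sideVal, Fin.zero_eta, Matrix.cons_val_zero] at hI hEm
    exact hEsc.turnCount_eq_of_top_east hm₀ (by rw [hm₀d]; exact hidx) (fun p hp => by rw [hm₀d]; exact hI p hp)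
      (fun m hm => by rw [hm₀d]; exact hEm m hm) ω ht horb
  · simp only [sideVal, Fin.mk_one, Matrix.cons_val_one, Matrix.cons_val_zero, neg_le_neg_iff] at hI hEm
    exact hEsc.turnCount_eq_of_west_north hm₀ (by rw [hm₀d]; exact hidx) (fun p hp => by rw [hm₀d]; exact hI p hp)
      (fun m hm => by rw [hm₀d]; exact hEm m hm) ω ht horb
  · simp only [sideVal, Fin.reduceFinMk, Matrix.cons_val, neg_le_neg_iff] at hI hEm
    exact hEsc.turnCount_eq_of_bot_west hm₀ (by rw [hm₀d]; exact hidx) (fun p hp => by rw [hm₀d]; exact hI p hp)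
      (fun m hm => by rw [hm₀d]; exact hEm m hm) ω ht horb
  · simp only [sideVal, Fin.reduceFinMk, Matrix.cons_val] at hI hEm
    exact hEsc.turnCount_eq_of_east_south hm₀ (by rw [hm₀d]; exact hidx) (fun p hp => by rw [hm₀d]; exact hI p hp)
      (fun m hm => by rw [hm₀d]; exact hEm m hm) ω ht horb

end GadgetA

section GadgetB

variable (hD : D.IsZdAdmissible) {u : Site 2} {j : Fin 4} {ds : List (Fin 4)}

/-- **A vertex path with forbidden corners entering through the start edge is an escape path.** Hypotheses: the
path has at least two steps, ends at the start vertex `x₀` arriving along `k₀ + 2` (from the `B`-end of the start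
edge), every corner of its corner walk after the first is forbidden, and its non-final vertices are pairwise
distinct. Conclusion: the corner walk is an escape path of `(u, j)` with escape sum `walkTurns j ds`.
[cite: DuminilCopinHonglerNolin2011, Lemma 12] -/
theorem cornerEscapeB_isEscape (hlen : 2 ≤ ds.length) (hend : pathEnd u ds = (startCorner hD).1)
    (hlast : lastDir ds = (startCorner hD).2 + 2)
    (hforb : ∀ d ∈ (cornerWalk u j ds).tail, ¬ D.IsInnerFace (cFace d) ∨ d.1 ∈ D.zdArcB)
    (hnodup : (pathVerts u ds).Nodup) :
    IsEscape D hD (u, j) (fun i => (cornerWalk u j ds).getD i (startCorner hD)) ((cornerWalk u j ds).length - 2) ∧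
      escapeSum (fun i => (cornerWalk u j ds).getD i (startCorner hD)) ((cornerWalk u j ds).length - 2) =
        walkTurns j ds := by
  have hds : ds ≠ [] := by rintro rfl; simp at hlen
  have hlen2 : (cornerWalk u j ds).length = ((cornerWalk u j ds).length - 2) + 2 := by
    have := length_le_length_cornerWalk u j ds
    omega
  -- the arrival corner at the end vertex is the start corner itself
  have harr : (pathEnd u ds, lastDir ds + 2) = startCorner hD := by
    rw [hend, hlast, fin4_add_two_add_two']
  have hEsc := IsEscape.of_list (hD := hD) (q := (u, j)) (cornerWalk u j ds) hlen2
    (by rw [head?_cornerWalk _ _ hds])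
    (isChain_cornerWalk u j ds)
    (by
      rw [← harr]
      have key := isSucc_getLast_cornerWalk u j ds.dropLast (lastDir ds)
      have heq : ds.dropLast ++ [lastDir ds] = ds := (eq_dropLast_append_lastDir hds).symm
      simp only [heq] at key
      exact key)
    hforb (nodup_cornerWalk hnodup)
  refine ⟨hEsc.1, ?_⟩
  rw [hEsc.2, ← harr, walkSign_cornerWalk u j hds]

/-- **The winding at a corner with a corner-forbidden vertex escape through the start edge, extreme corner for
the side functional.** If a corner `d` of the walk has index `j + 3` and maximises `sideVal j ∘ cpos` over all
corners with an inner face and over the walk, then at every passage of `(u, j)` before the exit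
`turnCount = -4 - walkTurns j ds`. [cite: DuminilCopinHonglerNolin2011, Lemma 12] -/
theorem turnCount_eq_of_cornerEscapeB_side (hlen : 2 ≤ ds.length) (hend : pathEnd u ds = (startCorner hD).1)
    (hlast : lastDir ds = (startCorner hD).2 + 2)
    (hforb : ∀ d ∈ (cornerWalk u j ds).tail, ¬ D.IsInnerFace (cFace d) ∨ d.1 ∈ D.zdArcB)
    (hnodup : (pathVerts u ds).Nodup)
    {d : Site 2 × Fin 4} (hd : d ∈ cornerWalk u j ds) (hidx : d.2 = j + 3)
    (hI : ∀ p : Site 2 × Fin 4, D.IsInnerFace (cFace p) → sideVal j (cpos p) ≤ sideVal j (cpos d))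
    (hE : ∀ d' ∈ cornerWalk u j ds, sideVal j (cpos d') ≤ sideVal j (cpos d))
    (ω : Percolation.BondConfig (Site 2)) {t : ℕ} (ht : t < exitTime hD ω)
    (horb : cornerOrbit (D.bcBondConfig ω) (startCorner hD) t = (u, j)) :
    turnCount (D.bcBondConfig ω) (startCorner hD) t = -4 - walkTurns j ds := by
  obtain ⟨hEsc, hsum⟩ := cornerEscapeB_isEscape hD hlen hend hlast hforb hnodup
  obtain ⟨m₀, hm₀, hm₀d⟩ := exists_index_of_mem_cornerWalk hD hd
  rw [← hsum]
  have hEm : ∀ m ≤ (cornerWalk u j ds).length - 2 + 1,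
      sideVal j (cpos ((cornerWalk u j ds).getD m (startCorner hD))) ≤ sideVal j (cpos d) :=
    fun m hm => hE _ (getD_mem_cornerWalk hD hlen hm)
  fin_cases j
  · simp only [sideVal, Fin.zero_eta, Matrix.cons_val_zero] at hI hEm
    exact hEsc.turnCount_eq_of_top_east hm₀ (by rw [hm₀d]; exact hidx) (fun p hp => by rw [hm₀d]; exact hI p hp)
      (fun m hm => by rw [hm₀d]; exact hEm m hm) ω ht horb
  · simp only [sideVal, Fin.mk_one, Matrix.cons_val_one, Matrix.cons_val_zero, neg_le_neg_iff] at hI hEm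
    exact hEsc.turnCount_eq_of_west_north hm₀ (by rw [hm₀d]; exact hidx) (fun p hp => by rw [hm₀d]; exact hI p hp)
      (fun m hm => by rw [hm₀d]; exact hEm m hm) ω ht horb
  · simp only [sideVal, Fin.reduceFinMk, Matrix.cons_val, neg_le_neg_iff] at hI hEm
    exact hEsc.turnCount_eq_of_bot_west hm₀ (by rw [hm₀d]; exact hidx) (fun p hp => by rw [hm₀d]; exact hI p hp)
      (fun m hm => by rw [hm₀d]; exact hEm m hm) ω ht horb
  · simp only [sideVal, Fin.reduceFinMk, Matrix.cons_val] at hI hEm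
    exact hEsc.turnCount_eq_of_east_south hm₀ (by rw [hm₀d]; exact hidx) (fun p hp => by rw [hm₀d]; exact hI p hp)
      (fun m hm => by rw [hm₀d]; exact hEm m hm) ω ht horb

end GadgetB

end Literature.Probability.LatticeModels
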